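import Summits.ValiantsHypothesis.ValiantsHypothesis.Theorems.SymPencilPerFourPeeledTwoPencilTransport

/-!
# Route `SymPencil` — inner rank of the `2 | 2` row split of `per_4`, PEELED case: the CASE-A
# two-pencil frames (`--supports` stmt-ValiantsHypothesis-5674 `SdcSuperquadratic`; (8,8) column,
# memo `NOTE-p8g15-5674-R2-two-pencil.md` §3/§4 (A_m recipe), §7; rung currency only)

The Hessian pencil of `…PeeledHessian` (val-lit-p6 g16, Case A of `NOTE-p6g16-5674-R2-peeled-ten.md`)
as two-pencil frame data: for `h₀, h₁, h₂ ≠ 0` pairwise distinct and `t ∉ {0, -h₁/h₂,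
-(h₁-h₀)/(h₂-h₀)}` (cleared), the points `z₀ = (h₁ + t h₂, -h₀, -t h₀, 0)`, `z₁ = (h₂, 0, -h₀, 0)`
give Hessian matrices `H₀ = 𝐇(z₀)` (invertible), `H₁ = 𝐇(z₁)` with the explicit eigenbasis
`(0,h₂,h₁,0), (h₂,0,h₀,0), (h₁,h₀,0,0), (1,1,1,-1)` and pairwise distinct eigenvalues
`h₂/(h₁+th₂), 0, 1/t, (h₂-h₀)/((h₁-h₀)+t(h₂-h₀))` (`caseA_data`, the computations of
`…PeeledHessian.htz_caseA` re-exported in the format of `…TwoPencilTransport.false_of_hess_frame`).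
**`false_of_caseA_frame`**: a reduced peeled family on `≤ 11` squares with `a₀` (non-zero
coordinates), `a₁`, such `h, t`, `ψ(a_j, a₀∘z_i) = 0` and `Q ≠ 0` is contradictory.  (In the A₃
recipe of the memo: `h = a₀ ∘ Ψᵀa₀` restricted to three pairwise distinct non-zero coordinates and
`a₁ ⊥` the columns `0,1,2` of `Ψ`; choosing them is the top file's task.)

Honest framing: one frame class of HR2(11); no cell closes here; the window of record, the crux
`SdcSuperquadratic` and `VP ≠ VNP` are untouched.  No definitions, no named facts. [folklore]
-/

noncomputable section

-- single-conjunct layout: Sub = Summit, duplicated namespace component intended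
set_option linter.dupNamespace false

namespace Summit.ValiantsHypothesis.ValiantsHypothesis.Theorems.SymPencilPerFourPeeledTwoPencilCaseA

open Matrix Finset Module
open Summit.ValiantsHypothesis.ValiantsHypothesis.Theorems.SymPencilPerFourPeeledTwoPencilTransport

universe u v

variable {K : Type u} [Field K]

/-- **Case-A Hessian pencil data** (after `…PeeledHessian.htz_caseA`): left inverse, explicit
eigenbasis with pairwise distinct eigenvalues, and inverse of the eigenvector matrix. [folklore] -/
theorem caseA_data [CharZero K] (h : Fin 4 → K) (t : K)
    (h0 : h 0 ≠ 0) (h1 : h 1 ≠ 0) (h2 : h 2 ≠ 0)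
    (h01 : h 0 ≠ h 1) (h02 : h 0 ≠ h 2) (h12 : h 1 ≠ h 2)
    (ht : t ≠ 0) (ht1 : h 1 + t * h 2 ≠ 0) (ht2 : (h 1 - h 0) + t * (h 2 - h 0) ≠ 0)
    (H₀ H₁ : Matrix (Fin 4) (Fin 4) K)
    (hH₀ : ∀ b l, H₀ b l = if b = l then 0 else
      ((![h 1 + t * h 2, -h 0, -(t * h 0), 0] : Fin 4 → K) 0 +
        (![h 1 + t * h 2, -h 0, -(t * h 0), 0] : Fin 4 → K) 1 +
        (![h 1 + t * h 2, -h 0, -(t * h 0), 0] : Fin 4 → K) 2 +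
        (![h 1 + t * h 2, -h 0, -(t * h 0), 0] : Fin 4 → K) 3) -
        (![h 1 + t * h 2, -h 0, -(t * h 0), 0] : Fin 4 → K) b -
        (![h 1 + t * h 2, -h 0, -(t * h 0), 0] : Fin 4 → K) l)
    (hH₁ : ∀ b l, H₁ b l = if b = l then 0 else
      ((![h 2, 0, -h 0, 0] : Fin 4 → K) 0 + (![h 2, 0, -h 0, 0] : Fin 4 → K) 1 +
        (![h 2, 0, -h 0, 0] : Fin 4 → K) 2 + (![h 2, 0, -h 0, 0] : Fin 4 → K) 3) -
        (![h 2, 0, -h 0, 0] : Fin 4 → K) b - (![h 2, 0, -h 0, 0] : Fin 4 → K) l) :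
    H₀⁻¹ * H₀ = 1 ∧
    (∀ j, H₁ *ᵥ (![![0, h 2, h 1, 0], ![h 2, 0, h 0, 0], ![h 1, h 0, 0, 0], ![1, 1, 1, -1]] :
        Fin 4 → Fin 4 → K) j =
      (![h 2 / (h 1 + t * h 2), 0, 1 / t, (h 2 - h 0) / ((h 1 - h 0) + t * (h 2 - h 0))] :
        Fin 4 → K) j •
      H₀ *ᵥ (![![0, h 2, h 1, 0], ![h 2, 0, h 0, 0], ![h 1, h 0, 0, 0], ![1, 1, 1, -1]] :
        Fin 4 → Fin 4 → K) j) ∧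
    (∀ i j, i ≠ j →
      (![h 2 / (h 1 + t * h 2), 0, 1 / t, (h 2 - h 0) / ((h 1 - h 0) + t * (h 2 - h 0))] :
        Fin 4 → K) i ≠
      (![h 2 / (h 1 + t * h 2), 0, 1 / t, (h 2 - h 0) / ((h 1 - h 0) + t * (h 2 - h 0))] :
        Fin 4 → K) j) ∧
    (Matrix.of (![![0, h 2, h 1, 0], ![h 2, 0, h 0, 0], ![h 1, h 0, 0, 0], ![1, 1, 1, -1]] :
        Fin 4 → Fin 4 → K))⁻¹ *
      Matrix.of (![![0, h 2, h 1, 0], ![h 2, 0, h 0, 0], ![h 1, h 0, 0, 0], ![1, 1, 1, -1]] :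
        Fin 4 → Fin 4 → K) = 1 := by
  -- explicit matrices (as in `…PeeledHessian.htz_caseA`)
  have e0 : H₀ = !![0, -(t * h 0), -h 0, -h 0 - t * h 0;
                    -(t * h 0), 0, h 1 + t * h 2, h 1 + t * h 2 - t * h 0;
                    -h 0, h 1 + t * h 2, 0, h 1 + t * h 2 - h 0;
                    -h 0 - t * h 0, h 1 + t * h 2 - t * h 0, h 1 + t * h 2 - h 0, 0] := by
    ext b l; rw [hH₀]
    fin_cases b <;> fin_cases l <;> simp <;> ring
  have e1 : H₁ = !![0, -h 0, 0, -h 0;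
                    -h 0, 0, h 2, h 2 - h 0;
                    0, h 2, 0, h 2;
                    -h 0, h 2 - h 0, h 2, 0] := by
    ext b l; rw [hH₁]
    fin_cases b <;> fin_cases l <;> simp <;> ring
  -- determinant
  have hunit : IsUnit H₀.det := by
    have s22 : Fin.succAbove (2 : Fin 4) (2 : Fin 3) = 3 := by decide
    have s32 : Fin.succAbove (3 : Fin 4) (2 : Fin 3) = 2 := by decide
    have s12 : Fin.succAbove (1 : Fin 4) (2 : Fin 3) = 3 := by decide
    have hd : H₀.det = -4 * t * h 0 ^ 2 * (h 1 + t * h 2) * ((h 1 - h 0) + t * (h 2 - h 0)) := by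
      rw [e0, Matrix.det_succ_row_zero]
      simp [Fin.sum_univ_succ, Matrix.det_fin_three, s22, s32, s12]
      ring
    rw [hd, isUnit_iff_ne_zero]
    have h4 : (-4 : K) ≠ 0 := by norm_num
    exact mul_ne_zero (mul_ne_zero (mul_ne_zero (mul_ne_zero h4 ht) (pow_ne_zero 2 h0)) ht1) ht2
  refine ⟨Matrix.nonsing_inv_mul H₀ hunit, ?_, ?_, ?_⟩
  · -- cleared eigen-relations, then divide
    set v : Fin 4 → Fin 4 → K :=
      ![![0, h 2, h 1, 0], ![h 2, 0, h 0, 0], ![h 1, h 0, 0, 0], ![1, 1, 1, -1]] with hvdef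
    have key : ∀ (α β : K) (w : Fin 4 → K), β ≠ 0 → β • H₁ *ᵥ w = α • H₀ *ᵥ w →
        H₁ *ᵥ w = (α / β) • H₀ *ᵥ w := by
      intro α β w hβ hc
      have := congrArg (fun z => β⁻¹ • z) hc
      simp only [smul_smul, inv_mul_cancel₀ hβ, one_smul] at this
      rw [this, div_eq_inv_mul]
    have c0 : (h 1 + t * h 2) • H₁ *ᵥ v 0 = h 2 • H₀ *ᵥ v 0 := by
      ext i; fin_cases i <;> simp [hvdef, e0, e1]
      all_goals ring
    have c1 : (1 : K) • H₁ *ᵥ v 1 = (0 : K) • H₀ *ᵥ v 1 := by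
      ext i; fin_cases i <;> simp [hvdef, e0, e1]
      all_goals ring
    have c2 : t • H₁ *ᵥ v 2 = (1 : K) • H₀ *ᵥ v 2 := by
      ext i; fin_cases i <;> simp [hvdef, e0, e1]
      all_goals ring
    have c3 : ((h 1 - h 0) + t * (h 2 - h 0)) • H₁ *ᵥ v 3 = (h 2 - h 0) • H₀ *ᵥ v 3 := by
      ext i; fin_cases i <;> simp [hvdef, e0, e1]
      all_goals ring
    intro j
    fin_cases j
    · simpa using key _ _ _ ht1 c0
    · simpa using key _ _ _ one_ne_zero c1
    · simpa using key _ _ _ ht c2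
    · simpa using key _ _ _ ht2 c3
  · -- pairwise distinct eigenvalues
    have n01 : h 2 / (h 1 + t * h 2) ≠ 0 := div_ne_zero h2 ht1
    have n02 : h 2 / (h 1 + t * h 2) ≠ 1 / t := by
      intro heq; rw [div_eq_div_iff ht1 ht] at heq
      exact h1 (by linear_combination -heq)
    have n03 : h 2 / (h 1 + t * h 2) ≠ (h 2 - h 0) / ((h 1 - h 0) + t * (h 2 - h 0)) := by
      intro heq; rw [div_eq_div_iff ht1 ht2] at heq
      have : h 0 * (h 1 - h 2) = 0 := by linear_combination heq
      rcases mul_eq_zero.1 this with h' | h'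
      · exact h0 h'
      · exact h12 (sub_eq_zero.1 h')
    have n12 : (0 : K) ≠ 1 / t := (one_div_ne_zero ht).symm
    have n13 : (0 : K) ≠ (h 2 - h 0) / ((h 1 - h 0) + t * (h 2 - h 0)) :=
      (div_ne_zero (sub_ne_zero.2 h02.symm) ht2).symm
    have n23 : 1 / t ≠ (h 2 - h 0) / ((h 1 - h 0) + t * (h 2 - h 0)) := by
      intro heq; rw [div_eq_div_iff ht ht2] at heq
      exact h01 (by linear_combination -heq)
    intro i j hij
    fin_cases i <;> fin_cases j
    all_goals first
      | exact absurd rfl hij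
      | simpa using n01 | simpa using n01.symm
      | simpa using n02 | simpa using n02.symm
      | simpa using n03 | simpa using n03.symm
      | simpa using n12 | simpa using n12.symm
      | simpa using n13 | simpa using n13.symm
      | simpa using n23 | simpa using n23.symm
  · -- the eigenvectors form a basis (`det = -2 h₀ h₁ h₂`)
    have hVunit : IsUnit (Matrix.of (![![0, h 2, h 1, 0], ![h 2, 0, h 0, 0], ![h 1, h 0, 0, 0],
        ![1, 1, 1, -1]] : Fin 4 → Fin 4 → K)).det := by
      have s22 : Fin.succAbove (2 : Fin 4) (2 : Fin 3) = 3 := by decide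
      have s32 : Fin.succAbove (3 : Fin 4) (2 : Fin 3) = 2 := by decide
      have s12 : Fin.succAbove (1 : Fin 4) (2 : Fin 3) = 3 := by decide
      have hd : (Matrix.of (![![0, h 2, h 1, 0], ![h 2, 0, h 0, 0], ![h 1, h 0, 0, 0],
          ![1, 1, 1, -1]] : Fin 4 → Fin 4 → K)).det = -(2 * h 0 * h 1 * h 2) := by
        rw [Matrix.det_succ_row_zero]
        simp [Fin.sum_univ_succ, Matrix.det_fin_three, s22, s12]
        ring
      rw [hd, isUnit_iff_ne_zero, neg_ne_zero]
      exact mul_ne_zero (mul_ne_zero (mul_ne_zero two_ne_zero h0) h1) h2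
    exact Matrix.nonsing_inv_mul _ hVunit

/-- **The Case-A two-pencil frame.**  See the module docstring. [folklore] -/
theorem false_of_caseA_frame [CharZero K] {κ : Type v} [Fintype κ] [DecidableEq κ]
    (hκ : Fintype.card κ ≤ 11) (c : κ → K)
    (t : κ → (((Fin 4 → K) × (Fin 4 → K)) →ₗ[K] ((Fin 4 → K) × (Fin 4 → K)) →ₗ[K] K))
    (hJ : ∀ a b y₂ y₃ : Fin 4 → K,
      ∑ r, c r * (t r (a, b) (y₂, y₃)) ^ 2 = (Matrix.of ![a, b, y₂, y₃]).permanent)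
    (v₀ v₀' : κ → K) (hv₀ : ∀ (a x : Fin 4 → K), ∃ s : K, (fun r => t r (a, 0) (x, 0)) = s • v₀)
    (hv₀' : ∀ (b x : Fin 4 → K), ∃ s : K, (fun r => t r (0, b) (0, x)) = s • v₀')
    (hpeel : ∃ a b y z : Fin 4 → K, ∑ r, c r * t r (a, 0) (y, 0) * t r (0, b) (0, z) ≠ 0)
    (a₀ a₁ : Fin 4 → K) (ha : ∀ k, a₀ k ≠ 0) (h : Fin 4 → K) (τ : K)
    (h0 : h 0 ≠ 0) (h1 : h 1 ≠ 0) (h2 : h 2 ≠ 0)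
    (h01 : h 0 ≠ h 1) (h02 : h 0 ≠ h 2) (h12 : h 1 ≠ h 2)
    (hτ : τ ≠ 0) (hτ1 : h 1 + τ * h 2 ≠ 0) (hτ2 : (h 1 - h 0) + τ * (h 2 - h 0) ≠ 0)
    (hψ₀₀ : ∀ r, t r (a₀, 0)
      ((fun k => a₀ k * (![h 1 + τ * h 2, -h 0, -(τ * h 0), 0] : Fin 4 → K) k), 0) = 0)
    (hψ₀₁ : ∀ r, t r (a₀, 0) ((fun k => a₀ k * (![h 2, 0, -h 0, 0] : Fin 4 → K) k), 0) = 0)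
    (hψ₁₀ : ∀ r, t r (a₁, 0)
      ((fun k => a₀ k * (![h 1 + τ * h 2, -h 0, -(τ * h 0), 0] : Fin 4 → K) k), 0) = 0)
    (hψ₁₁ : ∀ r, t r (a₁, 0) ((fun k => a₀ k * (![h 2, 0, -h 0, 0] : Fin 4 → K) k), 0) = 0)
    (H₀ : Matrix (Fin 4) (Fin 4) K)
    (hH₀ : ∀ b l, H₀ b l = if b = l then 0 else
      ((![h 1 + τ * h 2, -h 0, -(τ * h 0), 0] : Fin 4 → K) 0 +
        (![h 1 + τ * h 2, -h 0, -(τ * h 0), 0] : Fin 4 → K) 1 +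
        (![h 1 + τ * h 2, -h 0, -(τ * h 0), 0] : Fin 4 → K) 2 +
        (![h 1 + τ * h 2, -h 0, -(τ * h 0), 0] : Fin 4 → K) 3) -
        (![h 1 + τ * h 2, -h 0, -(τ * h 0), 0] : Fin 4 → K) b -
        (![h 1 + τ * h 2, -h 0, -(τ * h 0), 0] : Fin 4 → K) l)
    (hQ : (Matrix.of fun b l : Fin 4 =>
          (Matrix.of ![a₁, Pi.single b (1 : K),
            (fun k => a₀ k * (![h 2, 0, -h 0, 0] : Fin 4 → K) k), Pi.single l 1]).permanent) -
        (Matrix.of fun b l : Fin 4 =>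
          (Matrix.of ![a₀, Pi.single b (1 : K),
            (fun k => a₀ k * (![h 2, 0, -h 0, 0] : Fin 4 → K) k), Pi.single l 1]).permanent) *
        ((a₀ 0 * a₀ 1 * a₀ 2 * a₀ 3)⁻¹ • (Matrix.diagonal a₀ * H₀⁻¹ * Matrix.diagonal a₀)) *
        (Matrix.of fun b l : Fin 4 =>
          (Matrix.of ![a₁, Pi.single b (1 : K),
            (fun k => a₀ k * (![h 1 + τ * h 2, -h 0, -(τ * h 0), 0] : Fin 4 → K) k),
            Pi.single l 1]).permanent)
        ≠ 0) : False := by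
  let z₁ : Fin 4 → K := ![h 2, 0, -h 0, 0]
  let H₁ : Matrix (Fin 4) (Fin 4) K := Matrix.of fun b l : Fin 4 =>
    if b = l then (0 : K) else (z₁ 0 + z₁ 1 + z₁ 2 + z₁ 3) - z₁ b - z₁ l
  obtain ⟨hinv, hv, hs, hW⟩ := caseA_data h τ h0 h1 h2 h01 h02 h12 hτ hτ1 hτ2 H₀ H₁ hH₀
    (fun b l => rfl)
  exact false_of_hess_frame hκ c t hJ v₀ v₀' hv₀ hv₀' hpeel a₀ a₁
    (![h 1 + τ * h 2, -h 0, -(τ * h 0), 0]) z₁ ha hψ₀₀ hψ₀₁ hψ₁₀ hψ₁₁ H₀ H₁ hH₀ (fun b l => rfl)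
    H₀⁻¹ hinv _ _ hv hs _ hW hQ

end Summit.ValiantsHypothesis.ValiantsHypothesis.Theorems.SymPencilPerFourPeeledTwoPencilCaseA

end
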